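import Mathlib.Algebra.MvPolynomial.PDeriv
import Mathlib.RingTheory.Extension.Presentation.Basic
import Mathlib.LinearAlgebra.Matrix.Determinant.Basic
import HarnessLib

/-!
# Rescaling the generators of a presentation (step of Stacks 07F4)

Topic: `Literature/AlgebraicGeometry/Resolution`. Groundwork for Stacks, Lemma 07F4 (and
through it for `Stacks07F5_reduceToField`, `NeronPopescuSteps.lean`). In the proof of 07F4
the generators `x_i`, `i > n`, of a standard smooth presentation `B' = S⁻¹R[x]/(f)` are
multiplied by elements of `S` ("After multiplying `x_i`, `i > n` by an element of `S` and
correspondingly modifying the equations `f_j` we may assume `B' → S⁻¹Λ` maps `x_i` to `λ_i/1`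
for some `λ_i ∈ Λ`"). This file PROVES the bookkeeping behind "correspondingly modifying the
equations": for units `u_i` of the ground ring `K`, the `K`-algebra automorphism
`θ : x_i ↦ u_i⁻¹ x_i` of `K[x]` transports a presentation with generators `b_i` to one with
generators `u_i b_i` and relations `θ(f_j)`, and the partial derivatives (hence the Jacobian
minors) of the new relations are those of the old ones up to the units `u_i`:

* `pderiv_aeval_C_mul_X` — `∂/∂x_i (p(w x)) = w_i · (∂p/∂x_i)(w x)` for the substitution
  `x_j ↦ w_j x_j`; `det_pderiv_aeval_C_mul_X` — hence Jacobian minors change by the unit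
  `∏ w_{ι(i)}`;
* `aeval_smul_comp_aeval_C_mul_X` — evaluating at `u_i b_i` after `x_j ↦ u_j⁻¹ x_j` is
  evaluating at `b_i`;
* `ker_aeval_unit_smul` — `ker(x ↦ u b) = θ(ker(x ↦ b))`;
* `exists_presentation_unit_smul` — the rescaled presentation (same index types), with its
  relations `θ ∘ f`.

No new notions, no named facts.

## Sources

* The Stacks Project, *Smoothing Ring Maps* (Tag 07BW), proof of Lemma 07F4. [StacksProject]
-/

noncomputable section

open MvPolynomial

namespace Literature.AlgebraicGeometry.Resolution

universe u

section Scaling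

variable {K : Type u} [CommRing K] {ι : Type*}

/-- **Chain rule for a diagonal substitution**: for `θ_w : x_j ↦ w_j x_j`,
`∂(θ_w p)/∂x_i = w_i θ_w(∂p/∂x_i)`. [folklore] -/
theorem pderiv_aeval_C_mul_X (w : ι → K) (p : MvPolynomial ι K) (i : ι) :
    pderiv i (aeval (fun j => C (w j) * X j) p) =
      C (w i) * aeval (fun j => C (w j) * X j) (pderiv i p) := by
  induction p using MvPolynomial.induction_on with
  | C a => simp
  | add p q hp hq => rw [map_add, map_add, hp, hq, map_add, map_add, mul_add]
  | mul_X p j hp =>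
    by_cases hij : j = i
    · subst hij
      simp only [map_mul, map_add, aeval_X, pderiv_mul, pderiv_C, pderiv_X_self, hp, zero_mul,
        zero_add, mul_one]
      ring
    · simp only [map_mul, aeval_X, pderiv_mul, pderiv_C, pderiv_X_of_ne hij, hp, zero_mul,
        mul_zero, add_zero]
      ring

/-- Consequently a Jacobian minor of the substituted polynomials is the substituted minor times
the product of the `w_i` over the rows: `det(∂(θ_w f_j)/∂x_{ι(i)}) = (∏_i w_{ι(i)}) θ_w(det(∂f_j/∂x_{ι(i)}))`.
[folklore] -/
theorem det_pderiv_aeval_C_mul_X (w : ι → K) {m c : ℕ} (f : Fin m → MvPolynomial ι K)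
    (hc : c ≤ m) (e : Fin c → ι) :
    (Matrix.of fun i j : Fin c =>
        pderiv (e i) (aeval (fun k => C (w k) * X k) (f (Fin.castLE hc j)))).det =
      (∏ i : Fin c, C (w (e i))) *
        aeval (fun k => C (w k) * X k)
          (Matrix.of fun i j : Fin c => pderiv (e i) (f (Fin.castLE hc j))).det := by
  classical
  set θ : MvPolynomial ι K →ₐ[K] MvPolynomial ι K := aeval fun k => C (w k) * X k
  have hM : (Matrix.of fun i j : Fin c => pderiv (e i) (θ (f (Fin.castLE hc j)))) =
      Matrix.diagonal (fun i : Fin c => C (w (e i))) *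
        θ.mapMatrix (Matrix.of fun i j : Fin c => pderiv (e i) (f (Fin.castLE hc j))) := by
    refine Matrix.ext fun i j => ?_
    rw [Matrix.diagonal_mul, Matrix.of_apply, AlgHom.mapMatrix_apply, Matrix.map_apply,
      Matrix.of_apply]
    exact pderiv_aeval_C_mul_X w _ _
  rw [hM, Matrix.det_mul, Matrix.det_diagonal, ← AlgHom.map_det]

variable {B : Type u} [CommRing B] [Algebra K B]

/-- Evaluating at `u_i b_i` after the substitution `x_j ↦ v_j x_j` with `v_j u_j = 1` is
evaluating at `b_i`. [folklore] -/
theorem aeval_smul_comp_aeval_C_mul_X (b : ι → B) (u v : ι → K) (huv : ∀ i, v i * u i = 1) :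
    (aeval fun i => algebraMap K B (u i) * b i).comp (aeval fun j => C (v j) * X j) = aeval b := by
  refine MvPolynomial.algHom_ext fun i => ?_
  rw [AlgHom.comp_apply, aeval_X, map_mul, aeval_C, aeval_X, ← mul_assoc, ← map_mul, huv,
    map_one, one_mul, aeval_X]

/-- The two diagonal substitutions `x ↦ v x` and `x ↦ u x` with `v u = 1` are inverse to each
other. [folklore] -/
theorem aeval_C_mul_X_comp (u v : ι → K) (huv : ∀ i, v i * u i = 1) :
    (aeval fun j => C (u j) * (X j : MvPolynomial ι K)).comp (aeval fun j => C (v j) * X j) =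
      AlgHom.id K _ := by
  refine MvPolynomial.algHom_ext fun i => ?_
  rw [AlgHom.comp_apply, aeval_X, map_mul, aeval_C, aeval_X, ← mul_assoc, algebraMap_eq, ← C_mul,
    huv, C_1, one_mul, AlgHom.id_apply]

/-- **Kernel of the rescaled evaluation**: `ker(x_i ↦ u_i b_i) = θ(ker(x_i ↦ b_i))` for
`θ : x_j ↦ v_j x_j`, `v_j u_j = 1`. [folklore] -/
theorem ker_aeval_unit_smul (b : ι → B) (u v : ι → K) (huv : ∀ i, v i * u i = 1) :
    RingHom.ker (aeval fun i => algebraMap K B (u i) * b i) =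
      (RingHom.ker (aeval b : MvPolynomial ι K →ₐ[K] B)).map
        (aeval fun j => C (v j) * (X j : MvPolynomial ι K)) := by
  have hvu : ∀ i, u i * v i = 1 := fun i => by rw [mul_comm]; exact huv i
  set θ : MvPolynomial ι K →ₐ[K] MvPolynomial ι K := aeval fun j => C (v j) * X j
  set μ : MvPolynomial ι K →ₐ[K] MvPolynomial ι K := aeval fun j => C (u j) * X j
  have hθμ : ∀ p, θ (μ p) = p := fun p => by
    change (θ.comp μ) p = p
    rw [show θ.comp μ = AlgHom.id K _ from aeval_C_mul_X_comp v u hvu, AlgHom.id_apply]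
  have hμθ : ∀ p, μ (θ p) = p := fun p => by
    change (μ.comp θ) p = p
    rw [show μ.comp θ = AlgHom.id K _ from aeval_C_mul_X_comp u v huv, AlgHom.id_apply]
  have hcomp : ∀ p, aeval (fun i => algebraMap K B (u i) * b i) (θ p) = aeval b p := fun p => by
    rw [← AlgHom.comp_apply, aeval_smul_comp_aeval_C_mul_X b u v huv]
  apply le_antisymm
  · intro p hp
    rw [RingHom.mem_ker] at hp
    have hq : μ p ∈ RingHom.ker (aeval b : MvPolynomial ι K →ₐ[K] B) := by
      rw [RingHom.mem_ker]
      change aeval b (μ p) = 0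
      rw [← hcomp, hθμ]
      exact hp
    have : p = θ (μ p) := (hθμ p).symm
    rw [this]
    exact Ideal.mem_map_of_mem _ hq
  · rw [Ideal.map_le_iff_le_comap]
    intro q hq
    rw [RingHom.mem_ker] at hq
    rw [Ideal.mem_comap, RingHom.mem_ker]
    change aeval _ (θ q) = 0
    rw [hcomp]
    exact hq

/-- **The rescaled presentation.** Given a presentation of `B` over `K` with generators `b_i`
and units `u_i` (with inverses `v_i`), there is a presentation with the same index types,
generators `u_i b_i` and relations `θ(f_j)`, `θ : x_j ↦ v_j x_j` — the presentation obtained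
by "multiplying `x_i` by `u_i` and correspondingly modifying the equations" (proof of Stacks
07F4). [cite: StacksProject, Tag 07F4 (proof)] -/
theorem exists_presentation_unit_smul {σ : Type*} (P : Algebra.Presentation K B ι σ) (u v : ι → K)
    (huv : ∀ i, v i * u i = 1) :
    ∃ P' : Algebra.Presentation K B ι σ,
      (∀ i, P'.val i = algebraMap K B (u i) * P.val i) ∧
      ∀ j, P'.relation j = aeval (fun k => C (v k) * X k) (P.relation j) := by
  have hvu : ∀ i, u i * v i = 1 := fun i => by rw [mul_comm]; exact huv i
  let θ : MvPolynomial ι K →ₐ[K] MvPolynomial ι K := aeval fun j => C (v j) * X j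
  let val' : ι → B := fun i => algebraMap K B (u i) * P.val i
  have hsurj : Function.Surjective (aeval (R := K) val') := by
    intro x
    obtain ⟨p, hp⟩ := P.aeval_val_surjective x
    refine ⟨θ p, ?_⟩
    change aeval val' (θ p) = x
    rw [← AlgHom.comp_apply, aeval_smul_comp_aeval_C_mul_X P.val u v huv, hp]
  let G : Algebra.Generators K B ι := Algebra.Generators.ofSurjective val' hsurj
  refine ⟨{ toGenerators := G, relation := fun j => θ (P.relation j), span_range_relation_eq_ker := ?_ },
    fun i => rfl, fun j => rfl⟩
  rw [G.ker_eq_ker_aeval_val]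
  change Ideal.span (Set.range fun j => θ (P.relation j)) = RingHom.ker (aeval val')
  rw [ker_aeval_unit_smul P.val u v huv, ← P.ker_eq_ker_aeval_val, ← P.span_range_relation_eq_ker,
    Ideal.map_span, ← Set.range_comp]
  rfl

end Scaling

end Literature.AlgebraicGeometry.Resolution

end
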